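import Summits.CriticalPhenomena.PercolationContinuityZ3.Theorems.Transplant.D10SKc11_4513P2
import HarnessLib

/-!
# Diamond film `D_10` — KERNEL CERTIFICATE for the class `11_4513` of `ShapedLinkageX 4 (DiamondFilm.sqShadow (k := 10))`, THE CLASS (mask + coverage from the 2 parts) (template `fullmcp`, |W| = 181, 1806 terminal pairs, 5222 plans)

builds on p205010 (kernel theorem, internal audit signed; external expert review pending) — NOT used in this file.  Lane `prim-bschramm`, seat `prim-bschramm-p2` (gen 43; class C1b;
memo `HOME/bschramm/P2-LATTICES.md` §152); helper file (`--supports stmt-CriticalPhenomena-4575 --as helper`).  Generated by `cert/emit_dk.py` from the plans of `cert/gen_dk.py`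
(canonical BFS routings with avoid hints, exact mirror `cert/kern_dk.py` of «DkSKDefs»); re-checked here by the kernel (`DCtx.checkEs`); `caseOK_k10_11_4513` feeds «D10SKFinal».
[cite: DuminilCopinSidoraviciusTassion2016, §2.3 (proof of Fact 2: the three disjoint paths in B_R(z))]
-/

namespace Summit.CriticalPhenomena.PercolationContinuityZ3.Theorems.Transplant

namespace DiamondFilm.DK

/-- The cleared mask of the class `11_4513` of `D_10` is admissible (inside the cleared block, containing the forced core). [folklore] -/
theorem wOK_k10_11_4513 : DCtx.wOK (⟨10, 1, 1, 4, 5, 1, 3, 20025838124851364365988240333377230427085789217291274972679951435900607080715201744336079978167815753910163655720484978688⟩ : DCtx) = true := by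
  decide +kernel

/-- **THE CLASS `11_4513` OF `D_10` IS COVERED**: every needed bit of every certified terminal pair has a swap-pair plan. [cite: DuminilCopinSidoraviciusTassion2016, §2.3 (proof of Fact 2)] -/
theorem caseOK_k10_11_4513 : CaseOK (⟨10, 1, 1, 4, 5, 1, 3, 20025838124851364365988240333377230427085789217291274972679951435900607080715201744336079978167815753910163655720484978688⟩ : DCtx) :=
  caseOK_of_chunks _ [[14, 15, 16], [17, 18, 25], [37, 49, 61], [73, 85, 97], [110, 111, 112], [113, 114, 158], [159, 160, 161], [162, 169, 181], [193, 205, 217], [229, 241, 254], [255, 256, 257], [258, 302, 304], [306, 326, 350], [374, 398, 400], [402]]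
    (List.forall_mem_cons.2 ⟨checkEs_sound _ _ _ chunk_k10_11_4513_0, List.forall_mem_cons.2 ⟨checkEs_sound _ _ _ chunk_k10_11_4513_1, List.forall_mem_cons.2 ⟨checkEs_sound _ _ _ chunk_k10_11_4513_2, List.forall_mem_cons.2 ⟨checkEs_sound _ _ _ chunk_k10_11_4513_3, List.forall_mem_cons.2 ⟨checkEs_sound _ _ _ chunk_k10_11_4513_4, List.forall_mem_cons.2 ⟨checkEs_sound _ _ _ chunk_k10_11_4513_5, List.forall_mem_cons.2 ⟨checkEs_sound _ _ _ chunk_k10_11_4513_6, List.forall_mem_cons.2 ⟨checkEs_sound _ _ _ chunk_k10_11_4513_7, List.forall_mem_cons.2 ⟨checkEs_sound _ _ _ chunk_k10_11_4513_8, List.forall_mem_cons.2 ⟨checkEs_sound _ _ _ chunk_k10_11_4513_9, List.forall_mem_cons.2 ⟨checkEs_sound _ _ _ chunk_k10_11_4513_10, List.forall_mem_cons.2 ⟨checkEs_sound _ _ _ chunk_k10_11_4513_11, List.forall_mem_cons.2 ⟨checkEs_sound _ _ _ chunk_k10_11_4513_12, List.forall_mem_cons.2 ⟨checkEs_sound _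 _ _ chunk_k10_11_4513_13, List.forall_mem_cons.2 ⟨checkEs_sound _ _ _ chunk_k10_11_4513_14, List.forall_mem_nil _⟩⟩⟩⟩⟩⟩⟩⟩⟩⟩⟩⟩⟩⟩⟩)
    (by decide +kernel)

end DiamondFilm.DK

end Summit.CriticalPhenomena.PercolationContinuityZ3.Theorems.Transplant
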